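/-
Copyright: public-audit package `pub-balaban` (b2b-balaban), seat pv09-g4. Released under Apache 2.0 like Mathlib.
-/
import Literature.MathematicalPhysics.QuantumFieldTheory.Balaban1983to89.B6LayerWindow

/-!
# B6, p. 245: the optimal constant of the layer sentence as one number κ_opt(L), the same in every dimension

Source under audit: T. Bałaban, *Propagators and renormalization transformations for lattice gauge theories.
II*, Commun. Math. Phys. **96** (1984) 223–250 [B6], proof of Lemma 2.4, p. 245.  Capstone of the layer chain
`B6LayerPoincare` (κ₀) → `B6LayerPoincarePair` (κ₁) → `B6Lemma24Kappa` (`LayerIneq d L κ`) → `B6LayerUpperBound`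
(κ ≤ 12/(L+1)) → `B6LayerRayleigh` / `B6LayerDimTwo` / `B6LayerTensor` (`LayerIneq d L 1 ↔ L ≤ 9`; `LayerIneq d L κ ↔
LayerIneq 2 L κ`) → `B6LayerWindow` (`LayerIneq d L (min 1 (8/L))`): all imported untouched.

## The printed sentence (verbatim, p. 245, between (2.126) and (2.127))

*"The terms in parentheses on the right-hand side can be written as L^{−2}⟨B, (Δ_{Δ′}^{L^{−1},N} +
Q′*_{Δ′}Q′_{Δ′})B⟩, where the operators are defined on a d − 1-dimensional lattice.  This quadratic form is
bounded from below by L^{−d−1} Σ_{x∈Δ′} |B_μ(x)|², hence"* [(2.127) follows].  (Same quotation as in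
`B6LayerPoincare`, `B6LayerUpperBound`, `B6LayerRayleigh`, `B6LayerDimTwo`, `B6LayerTensor`, `B6LayerWindow`; copied from
`B6LayerWindow`, whose copy was checked against the render.)  The sentence is `LayerIneq d L 1`; it is false for L ≥ 10 and true for L ≤ 9 in every d ≥ 2 (`B6LayerTensor`).

## What this file proves (all [folklore]; nothing printed is asserted or used)

The companions decide the printed factor and bound the admissible constants from both sides; this file turns them
into statements about ONE NUMBER.  `admissible d L = {κ | LayerIneq d L κ}` is closed (`isClosed_admissible`: an
intersection of closed half-lines, κ enters linearly), downward closed (`LayerIneq.mono`), nonempty and bounded above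
by 1 (d ≥ 2, L ≥ 1).  Hence, with `kappaOpt d L := sSup (admissible d L)`:

* `kappaOpt_mem`, `isGreatest_kappaOpt` — the supremum is ATTAINED: `LayerIneq d L (kappaOpt d L)`;
  `layerIneq_iff_le` / `admissible_eq_Iic` — **`LayerIneq d L κ ↔ κ ≤ kappaOpt d L`**: the layer sentence with
  constant κ holds exactly for κ ≤ κ_opt.
* `kappaOpt_eq_two` — **κ_opt(d, L) = κ_opt(2, L) for every d ≥ 2** (`B6LayerTensor.layerIneq_iff_two`): one number
  per L.
* `kappaOpt_eq_one_iff` — **κ_opt = 1 ↔ L ≤ 9** (`B6LayerTensor.layerIneq_one_iff`); `kappaOpt_lt_one` (L ≥ 10);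
  `kappaOpt_pos`, `kappaOpt_le_one`.
* `kappaOpt_window` — **8/L ≤ κ_opt ≤ 12/(L+1) for L ≥ 8** (`B6LayerWindow.layerIneq_eight_div`,
  `B6LayerUpperBound.layerIneq_le`); `min_le_kappaOpt` (min(1, 8/L) ≤ κ_opt, every L ≥ 1), `kappaOpt_le_twelve_div`
  (every L ≥ 1); `layer_constant_summary` collects the five facts.

So the printed sentence *"bounded from below by L^{−d−1} Σ |B_μ(x)|²"* is correct exactly when the block side is
L ≤ 9, and for the L of the paper (large) the right statement is *"bounded from below by κ_opt(L)·L^{−d−1} Σ |B_μ(x)|²"*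
with a number κ_opt(L) ∈ [8/L, 12/(L+1)] that does not depend on d.

## HONEST SCOPE

Nothing printed is asserted.  The VALUE of κ_opt(L) for L ≥ 10 (= 4L sin²(π/2L) by the spectral theory of the path,
→ π²/L) is not identified here — only the window.  Nothing is said about the constant of (2.128) (census G-B6-09R).
-/

namespace Literature.MathematicalPhysics.QuantumFieldTheory.Balaban1983to89.B6LayerOptimal

open Set
open B6Lemma24Kappa (LayerIneq)
open B6LayerTensor (kappa_le_one_of_layerIneq layerIneq_iff_two layerIneq_one_iff)
open B6LayerWindow (layerIneq_lower layerIneq_eight_div)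
open B6LayerUpperBound (layerIneq_le)

variable {d L : ℕ}

/-- The set of admissible constants of the layer sentence. [folklore] -/
def admissible (d L : ℕ) : Set ℝ := {κ | LayerIneq d L κ}

/-- The optimal constant: the supremum of the admissible set (a maximum, `kappaOpt_mem`). [folklore] -/
noncomputable def kappaOpt (d L : ℕ) : ℝ := sSup (admissible d L)

/-- Membership unfolds to the layer inequality. [folklore] -/
theorem mem_admissible {κ : ℝ} : κ ∈ admissible d L ↔ LayerIneq d L κ := Iff.rfl

/-- The admissible set is closed (an intersection of closed half-lines). [folklore] -/
theorem isClosed_admissible : IsClosed (admissible d L) := by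
  have : admissible d L = ⋂ (y : Fin d → ℤ) (μ : Fin d) (g : (Fin d → ℤ) → ℝ),
      {κ : ℝ | κ * ((L : ℝ)⁻¹) ^ (d + 1) * ∑ x ∈ B6FaceInterpolation.lastLayer L y μ, g x ^ 2 ≤
        ((L : ℝ)⁻¹) ^ d * B6LayerPoincare.gradSq g (B6FaceInterpolation.lastLayer L y μ) +
          ((L : ℝ)⁻¹) ^ 2 * (((L : ℝ)⁻¹) ^ (d - 1) * ∑ x ∈ B6FaceInterpolation.lastLayer L y μ, g x) ^ 2} := by
    ext κ; simp only [admissible, LayerIneq, mem_setOf_eq, mem_iInter]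
  rw [this]
  refine isClosed_iInter fun y => isClosed_iInter fun μ => isClosed_iInter fun g => ?_
  exact isClosed_le (by fun_prop) continuous_const

/-- It is downward closed (`LayerIneq.mono`). [folklore] -/
theorem mem_admissible_of_le {κ κ' : ℝ} (h : κ' ≤ κ) (hκ : κ ∈ admissible d L) : κ' ∈ admissible d L :=
  B6Lemma24Kappa.LayerIneq.mono h hκ

/-- It is nonempty (d ≥ 2, L ≥ 1): min(1, 8/L) is admissible (`B6LayerWindow.layerIneq_lower`). [folklore] -/
theorem admissible_nonempty (hd : 2 ≤ d) (hL : 1 ≤ L) : (admissible d L).Nonempty :=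
  ⟨_, layerIneq_lower hd hL⟩

/-- It is bounded above by 1 (`B6LayerTensor.kappa_le_one_of_layerIneq`). [folklore] -/
theorem admissible_bddAbove (hd : 2 ≤ d) (hL : 1 ≤ L) : BddAbove (admissible d L) :=
  ⟨1, fun _ h => kappa_le_one_of_layerIneq hd hL h⟩

/-- **The supremum is attained:** `kappaOpt d L` is itself admissible (d ≥ 2, L ≥ 1). [folklore] -/
theorem kappaOpt_mem (hd : 2 ≤ d) (hL : 1 ≤ L) : LayerIneq d L (kappaOpt d L) :=
  isClosed_admissible.csSup_mem (admissible_nonempty hd hL) (admissible_bddAbove hd hL)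

/-- **The admissible constants are exactly the κ ≤ κ_opt.** [folklore] -/
theorem layerIneq_iff_le (hd : 2 ≤ d) (hL : 1 ≤ L) {κ : ℝ} : LayerIneq d L κ ↔ κ ≤ kappaOpt d L :=
  ⟨fun h => le_csSup (admissible_bddAbove hd hL) h, fun h => (kappaOpt_mem hd hL).mono h⟩

/-- Equivalently `admissible d L = Iic (kappaOpt d L)`. [folklore] -/
theorem admissible_eq_Iic (hd : 2 ≤ d) (hL : 1 ≤ L) : admissible d L = Iic (kappaOpt d L) :=
  Set.ext fun _ => layerIneq_iff_le hd hL

/-- **Dimension independence of the optimal constant:** κ_opt(d, L) = κ_opt(2, L) (d ≥ 2). [folklore] -/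
theorem kappaOpt_eq_two (hd : 2 ≤ d) : kappaOpt d L = kappaOpt 2 L := by
  have : admissible d L = admissible 2 L := Set.ext fun κ => layerIneq_iff_two hd κ
  rw [kappaOpt, kappaOpt, this]

/-- 0 < κ_opt ≤ 1 (d ≥ 2, L ≥ 1). [folklore] -/
theorem kappaOpt_pos (hd : 2 ≤ d) (hL : 1 ≤ L) : 0 < kappaOpt d L := by
  have hL0 : (0 : ℝ) < L := by exact_mod_cast hL
  have h := (layerIneq_iff_le hd hL).1 (layerIneq_lower hd hL)
  exact lt_of_lt_of_le (lt_min one_pos (by positivity)) h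

/-- κ_opt ≤ 1. [folklore] -/
theorem kappaOpt_le_one (hd : 2 ≤ d) (hL : 1 ≤ L) : kappaOpt d L ≤ 1 :=
  kappa_le_one_of_layerIneq hd hL (kappaOpt_mem hd hL)

/-- **κ_opt = 1 exactly for L ≤ 9** (the printed factor; `B6LayerTensor.layerIneq_one_iff`). [folklore] -/
theorem kappaOpt_eq_one_iff (hd : 2 ≤ d) (hL : 1 ≤ L) : kappaOpt d L = 1 ↔ L ≤ 9 := by
  rw [← layerIneq_one_iff (L := L) hd, layerIneq_iff_le hd hL]
  exact ⟨fun h => h.ge, fun h => le_antisymm (kappaOpt_le_one hd hL) h⟩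

/-- For L ≥ 10 the optimal constant is < 1. [folklore] -/
theorem kappaOpt_lt_one (hd : 2 ≤ d) (hL : 10 ≤ L) : kappaOpt d L < 1 :=
  lt_of_le_of_ne (kappaOpt_le_one hd (by omega)) fun h => by
    have := (kappaOpt_eq_one_iff hd (by omega)).1 h; omega

/-- **The window:** 8/L ≤ κ_opt ≤ 12/(L+1) for every d ≥ 2 and L ≥ 8 (`B6LayerWindow`, `B6LayerUpperBound`).
[folklore] -/
theorem kappaOpt_window (hd : 2 ≤ d) (hL : 8 ≤ L) :
    8 / (L : ℝ) ≤ kappaOpt d L ∧ kappaOpt d L ≤ 12 / ((L : ℝ) + 1) :=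
  ⟨(layerIneq_iff_le hd (by omega)).1 (layerIneq_eight_div hd hL),
    layerIneq_le hd (by omega) (kappaOpt_mem hd (by omega))⟩

/-- The lower end for every L ≥ 1: min(1, 8/L) ≤ κ_opt. [folklore] -/
theorem min_le_kappaOpt (hd : 2 ≤ d) (hL : 1 ≤ L) : min 1 (8 / (L : ℝ)) ≤ kappaOpt d L :=
  (layerIneq_iff_le hd hL).1 (layerIneq_lower hd hL)


/-- κ_opt ≤ 12/(L+1) for every L ≥ 1 (for L = 1 from κ_opt ≤ 1). [folklore] -/
theorem kappaOpt_le_twelve_div (hd : 2 ≤ d) (hL : 1 ≤ L) : kappaOpt d L ≤ 12 / ((L : ℝ) + 1) := by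
  rcases Nat.lt_or_ge L 2 with h2 | h2
  · have hL1 : (L : ℝ) = 1 := by exact_mod_cast (show L = 1 by omega)
    rw [hL1]; linarith [kappaOpt_le_one hd hL]
  · exact layerIneq_le hd h2 (kappaOpt_mem hd hL)

/-- κ_opt is the greatest admissible constant. [folklore] -/
theorem isGreatest_kappaOpt (hd : 2 ≤ d) (hL : 1 ≤ L) : IsGreatest (admissible d L) (kappaOpt d L) :=
  ⟨kappaOpt_mem hd hL, fun _ h => (layerIneq_iff_le hd hL).1 h⟩

/-- **Summary (d ≥ 2, L ≥ 1).**  κ_opt(d, L) is the greatest admissible constant; it equals κ_opt(2, L); it is 1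
exactly when L ≤ 9; and min(1, 8/L) ≤ κ_opt ≤ 12/(L+1). [folklore] -/
theorem layer_constant_summary (hd : 2 ≤ d) (hL : 1 ≤ L) :
    IsGreatest (admissible d L) (kappaOpt d L) ∧ kappaOpt d L = kappaOpt 2 L ∧
      (kappaOpt d L = 1 ↔ L ≤ 9) ∧ min 1 (8 / (L : ℝ)) ≤ kappaOpt d L ∧ kappaOpt d L ≤ 12 / ((L : ℝ) + 1) :=
  ⟨isGreatest_kappaOpt hd hL, kappaOpt_eq_two hd, kappaOpt_eq_one_iff hd hL, min_le_kappaOpt hd hL,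
    kappaOpt_le_twelve_div hd hL⟩

end Literature.MathematicalPhysics.QuantumFieldTheory.Balaban1983to89.B6LayerOptimal
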